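import Summits.QuantumFields.YangMills.Theorems.BalabanUVNodesN18KingModelLargeField

/-!
# BalabanUVNodes ∕ node N18 → N19∕N20 → apex: KING'S GAUSSIAN MODEL, THE PRINTED RADIUS CHOICE `R_K² = R₀² + c·K` — the two rate conditions of `…N18KingModelLargeField` DISCHARGED,
# leaving ONE numeric condition on the initial radius; the generating functions of the full-space dressed Gaussian effective measures are Cauchy in the run length

Cell `pub-ymgap`, HUMAN RULING D-0062 (Track A), R134 ACCELERATION seat `pub-ymgap-dag-n14-c` re-pointed to **N18-b** (dag-lead REBALANCE №67), generation 6, fifth N18 module; route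
`Summits/QuantumFields/YangMills/Theses/BalabanUVNodes.lean` rev 18∕19 (K3⁗ `SpineGivenEndpointR13Sep` = stmt-QuantumFields-20292, `--supports … --as helper`); venue R424 (namespace
`YMDAG.N18.KingModelGaussianLimit`).  ADDITIVE — imports this seat's `…N18KingModelLargeField` (★★★ `cauchy_genFun_kingTwoClass`: the two-class King tower with NE7b's weight PRODUCED) and,
through it, the tree's `King1986/CovarianceRateTorus` (`thetaK_le`, `thetaBar`); THEOREMS ONLY (0 `def`), modifies nothing.

WHAT THIS FILE PROVES.  With the small-field radius growing like King's `p(L^kε) ~ √(log)` — here the affine-in-`K` choice `R_K = √(R₀² + c·K)`, `c > 0` — the two rate conditions of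
`cauchy_genFun_kingTwoClass` hold: the large-field weights `W_K = e^{2l₀B}·√2^{|Tor M|}·e^{−γ₀(R₀² + cK)/4}` are GEOMETRIC (`weight_affine_eq`, `summable_weight_affine`) and `< 1` as soon as
`W_0 < 1` (`weight_affine_lt_one`), and the core radius `θ_{K+1}·a·(R₀² + cK)·|Tor M|/(2vol)` is summable (`summable_radius_affine`: `θ_{K+1} ≤ θ̄·L^{−2(K+1)}` by `thetaK_le`, affine ×
geometric); §2 ★★ `tiltedMeanMatching_kingTwoClass` — N14's binder `TiltedMeanMatching` on the two-class King tower of `…KingModelLargeField` (general radii; the binder reads the good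
class only); `exists_core_summable_kingTwoClass` (the K3⁗ keyed-core-edge SHAPE `∃ δ, Core … ∧ Summable δ` on the two-class tower).  Hence ★★★ **`cauchy_genFun_kingGaussian`**: for `a, m² > 0`, `L ≥ 2`, `vol > 0`, `l₀ ≥ 0`, `c > 0`, a bounded measurable unit-scale observable `W` (`|W| ≤ B`) and ONE numeric
condition `e^{2l₀B}·√2^{|Tor M|}·e^{−γ₀R₀²/4} < 1` (`γ₀ = ((a(1 − L⁻²))⁻¹ + m⁻²)⁻¹`), the FULL-SPACE dressed Gaussian partition functions `Z K t = ∫ exp(−½φ·Δ^{(K+1)}φ)·e^{tWφ} dφ` of King's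
block-RG effective measures on the unit torus satisfy NE7 `MatchingModConstants` with a summable remainder, and their generating functions `log Z_K(t) − log Z_K(0)` are CAUCHY in `K`,
uniformly on `|t| ≤ l₀` — the apex statement of the spine, IN THE PRINTED MODEL, every hypothesis of the spine's NE7 assembly discharged.

HONEST FRAMING.  King's `A = 0` scalar MODEL, periodic b.c., `m² > 0` (template literature); the elementary Gaussian large-field estimate of the EFFECTIVE unit-lattice measure, NOT King's
T_K(χ) expansion, NOT Bałaban's NE7b ∕ NE7 for gauge fields (NOT PRINTED; NODE O ∕ N20 objects); count-neutral; N18 ∕ N19 ∕ N20 ∕ N27 NOT discharged; counts UNMOVED.  Everything is PROVED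
(0 `sorry`, 0 named facts).  One finite four-torus programme at fixed ε; NOT ℝ⁴, NOT OS, NOT a mass gap, NOT Clay.
-/

noncomputable section

namespace YMDAG.N18.KingModelGaussianLimit

open MeasureTheory Set Filter Finset Real Matrix Topology
open scoped ENNReal BigOperators
open YMDAG.N18.KingModelDens (kingTheta_nonneg)
open YMDAG.N18.KingModelLargeField (cauchy_genFun_kingTwoClass gamma0_pos)
open Literature.MathematicalPhysics.QuantumFieldTheory.King1986 (aK thetaK aK_pos)
open Literature.MathematicalPhysics.QuantumFieldTheory.King1986.Torus (effLaplacian aminL aminL_pos thetaBar thetaK_le)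
open Literature.MathematicalPhysics.QuantumFieldTheory.Balaban1983to89.B5Prop11Plancherel (Tor)
open Literature.MathematicalPhysics.QuantumFieldTheory.Balaban1983to89.T4CauchySum (MatchingModConstants genFun genFunLim)
open Literature.MathematicalPhysics.QuantumFieldTheory.Balaban1983to89.T4HybridMatching (hybridDelta)

/-! ## §1 The affine squared radius: weights geometric, core radius summable -/
section Affine

/-- `√(R₀² + cK)² = R₀² + cK`. [folklore] -/
theorem sq_sqrt_affine (R₀ : ℝ) {c : ℝ} (hc : 0 ≤ c) (K : ℕ) : Real.sqrt (R₀ ^ 2 + c * K) ^ 2 = R₀ ^ 2 + c * K :=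
  Real.sq_sqrt (by positivity)

/-- The large-field weight along the affine radius is GEOMETRIC: `C·e^{−γ(R₀² + cK)/4} = (C·e^{−γR₀²/4})·(e^{−γc/4})^K`. [folklore] -/
theorem weight_affine_eq (C γ R₀ c : ℝ) (hc : 0 ≤ c) (K : ℕ) :
    C * Real.exp (-(γ * Real.sqrt (R₀ ^ 2 + c * K) ^ 2 / 4)) = C * Real.exp (-(γ * R₀ ^ 2 / 4)) * Real.exp (-(γ * c / 4)) ^ K := by
  rw [sq_sqrt_affine R₀ hc, ← Real.exp_nat_mul, mul_assoc, ← Real.exp_add]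
  congr 2
  ring

/-- … hence summable (`γ, c > 0`). [folklore] -/
theorem summable_weight_affine (C : ℝ) {γ c : ℝ} (hγ : 0 < γ) (hc : 0 < c) (R₀ : ℝ) :
    Summable fun K : ℕ => C * Real.exp (-(γ * Real.sqrt (R₀ ^ 2 + c * K) ^ 2 / 4)) := by
  simp_rw [weight_affine_eq C γ R₀ c hc.le]
  refine (summable_geometric_of_lt_one (Real.exp_pos _).le ?_).mul_left _
  exact Real.exp_lt_one_iff.2 (by nlinarith)

/-- … and `< 1` at every `K` as soon as it is `< 1` at `K = 0` (`C ≥ 0`). [folklore] -/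
theorem weight_affine_lt_one {C γ c : ℝ} (hC : 0 ≤ C) (hγ : 0 ≤ γ) (hc : 0 ≤ c) {R₀ : ℝ} (h0 : C * Real.exp (-(γ * R₀ ^ 2 / 4)) < 1) (K : ℕ) :
    C * Real.exp (-(γ * Real.sqrt (R₀ ^ 2 + c * K) ^ 2 / 4)) < 1 := by
  rw [weight_affine_eq C γ R₀ c hc]
  have hq : Real.exp (-(γ * c / 4)) ^ K ≤ 1 := pow_le_one₀ (Real.exp_pos _).le (Real.exp_le_one_iff.2 (by nlinarith))
  have h1 : 0 ≤ C * Real.exp (-(γ * R₀ ^ 2 / 4)) := by positivity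
  calc C * Real.exp (-(γ * R₀ ^ 2 / 4)) * Real.exp (-(γ * c / 4)) ^ K ≤ C * Real.exp (-(γ * R₀ ^ 2 / 4)) * 1 := mul_le_mul_of_nonneg_left hq h1
    _ < 1 := by rw [mul_one]; exact h0

/-- **THE CORE RADIUS IS SUMMABLE ALONG THE AFFINE RADIUS**: `Σ_K θ_{K+1}·a·(R₀² + cK)·|Tor M|/(2vol) < ∞` — `θ_{K+1} ≤ θ̄·L^{−2(K+1)}` (tree `thetaK_le`) and an affine function times a geometric
sequence is summable. [folklore] -/
theorem summable_radius_affine {d : ℕ} (M : Fin d → ℕ) [∀ μ, NeZero (M μ)] {a : ℝ} (ha : 0 < a) {L : ℕ} (hL : 2 ≤ L) {vol : ℝ} (hvol : 0 < vol) (R₀ : ℝ) {c : ℝ}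
    (hc : 0 ≤ c) : Summable fun K : ℕ => thetaK a L (K + 1) 1 * a * (Real.sqrt (R₀ ^ 2 + c * K) ^ 2 * Fintype.card (Tor M)) / 2 / vol := by
  have hL1 : (1 : ℝ) < L := by exact_mod_cast hL
  set q : ℝ := ((L : ℝ) ^ 2)⁻¹ with hq
  have hq0 : 0 ≤ q := inv_nonneg.2 (sq_nonneg _)
  have hq1 : q < 1 := inv_lt_one_of_one_lt₀ (by nlinarith)
  have hθbar : 0 ≤ thetaBar a L := by
    have := (inv_pos.2 (aminL_pos ha hL)).le
    unfold thetaBar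
    positivity
  -- the dominating summable sequence: (affine in `K`) × (geometric in `K`)
  have hdom : Summable fun K : ℕ => thetaBar a L * q * (a * Fintype.card (Tor M) / 2 / vol) * ((R₀ ^ 2) * q ^ K + c * ((K : ℝ) ^ 1 * q ^ K)) := by
    refine Summable.mul_left _ (Summable.add ((summable_geometric_of_lt_one hq0 hq1).mul_left _) (Summable.mul_left _ ?_))
    exact summable_pow_mul_geometric_of_norm_lt_one 1 (by rwa [Real.norm_eq_abs, abs_of_nonneg hq0])
  refine Summable.of_nonneg_of_le (fun K => ?_) (fun K => ?_) hdom
  · have := kingTheta_nonneg ha hL (k := K + 1) (n := 1) (by omega) le_rfl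
    positivity
  · have hθ := thetaK_le ha hL (k := K + 1) (n := 1) (by omega) le_rfl
    have hpow : ((((L : ℝ)) ^ (K + 1)) ^ 2)⁻¹ = q ^ K * q := by
      rw [hq, ← pow_succ, ← inv_pow]; ring
    rw [hpow] at hθ
    rw [sq_sqrt_affine R₀ hc, pow_one]
    have hrest : 0 ≤ a * ((R₀ ^ 2 + c * K) * Fintype.card (Tor M)) / 2 / vol := by positivity
    calc thetaK a L (K + 1) 1 * a * ((R₀ ^ 2 + c * K) * Fintype.card (Tor M)) / 2 / vol
        = thetaK a L (K + 1) 1 * (a * ((R₀ ^ 2 + c * K) * Fintype.card (Tor M)) / 2 / vol) := by ring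
      _ ≤ thetaBar a L * (q ^ K * q) * (a * ((R₀ ^ 2 + c * K) * Fintype.card (Tor M)) / 2 / vol) := mul_le_mul_of_nonneg_right hθ hrest
      _ = thetaBar a L * q * (a * Fintype.card (Tor M) / 2 / vol) * ((R₀ ^ 2) * q ^ K + c * ((K : ℝ) * q ^ K)) := by ring

end Affine

/-! ## §2 N14's binder on the two-class King tower (general radii) -/
section Binder

open Summit.QuantumFields.BalabanUV.T4Continuum.NE1p.DressedMGFForm (TiltedMeanMatching)
open Summit.QuantumFields.YangMills.BalabanUVNodes.N19DensityRoad (tiltedMeanMatching_of_vacuumDens)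
open YMDAG.N18.KingModelDens (exp_neg_sandwich_of_abs_sub_le)
open YMDAG.N18.KingModelDensTorus (abs_action_sub_le_torus_of_eq measurable_dotProduct_mulVec ae_dotProduct_le_smallField)
open YMDAG.N18.KingModelLargeField (integrable_exp_neg_action effLaplacian_coercive_unif)

variable {d : ℕ} (M : Fin d → ℕ) [hM : ∀ μ, NeZero (M μ)] {l₀ B : ℝ} {W : (Tor M → ℝ) → ℝ} {R : ℕ → ℝ}

/-- **★★ N14's BINDER ON THE TWO-CLASS KING TOWER** [folklore ∘ `KingModelLargeField` §1∕§3 + n19-d `tiltedMeanMatching_of_vacuumDens`]: the dressed class laws of the two runs (`Δ^{(K+1)}` vs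
`Δ^{(K+2)}`, pieces = small-field box `|φ(x)| ≤ R_K` and its complement, bad class `{true}`) satisfy `TiltedMeanMatching l₀ univ {true} W (run A) W (run B) (K ↦ B·(e^{θ_{K+1}·a·R_K²|Tor M|} − 1))`
— the binder reads the GOOD class only; integrability of the bad piece from the full-space Gaussian bound. -/
theorem tiltedMeanMatching_kingTwoClass {a : ℝ} (ha : 0 < a) {L : ℕ} [NeZero L] (hL : 2 ≤ L) {m2 : ℝ} (hm : 0 < m2) (hB : 0 ≤ B) (hWm : Measurable W) (hWb : ∀ φ, |W φ| ≤ B) :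
    TiltedMeanMatching l₀ (fun _ => (Finset.univ : Finset Bool)) (fun _ _ => ({true} : Finset Bool)) (fun _ => W)
      (fun K τ => ((volume : Measure (Tor M → ℝ)).restrict (bif τ then {φ : Tor M → ℝ | ∀ x, |φ x| ≤ R K}ᶜ else {φ : Tor M → ℝ | ∀ x, |φ x| ≤ R K})).withDensity
        fun φ => ENNReal.ofReal (Real.exp (-(φ ⬝ᵥ (effLaplacian (L ^ (K + 1)) M (aK a L (K + 1)) (((L ^ (K + 1) : ℕ) : ℝ) ^ 2) m2 *ᵥ φ) / 2))))
      (fun _ => W)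
      (fun K τ => ((volume : Measure (Tor M → ℝ)).restrict (bif τ then {φ : Tor M → ℝ | ∀ x, |φ x| ≤ R K}ᶜ else {φ : Tor M → ℝ | ∀ x, |φ x| ≤ R K})).withDensity
        fun φ => ENNReal.ofReal (Real.exp (-(φ ⬝ᵥ (effLaplacian (L ^ (K + 1 + 1)) M (aK a L (K + 1 + 1)) (((L ^ (K + 1 + 1) : ℕ) : ℝ) ^ 2) m2 *ᵥ φ) / 2))))
      fun K => B * (Real.exp (2 * (thetaK a L (K + 1) 1 * a * (R K ^ 2 * Fintype.card (Tor M)) / 2)) - 1) := by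
  have hγ := gamma0_pos ha hL hm
  refine tiltedMeanMatching_of_vacuumDens (Ω := fun _ => Tor M → ℝ)
    (μ := fun K τ => (volume : Measure (Tor M → ℝ)).restrict (bif τ then {φ : Tor M → ℝ | ∀ x, |φ x| ≤ R K}ᶜ else {φ : Tor M → ℝ | ∀ x, |φ x| ≤ R K}))
    (W := fun _ => W)
    (fA := fun K _ φ => Real.exp (-(φ ⬝ᵥ (effLaplacian (L ^ (K + 1)) M (aK a L (K + 1)) (((L ^ (K + 1) : ℕ) : ℝ) ^ 2) m2 *ᵥ φ) / 2)))
    (fB := fun K _ φ => Real.exp (-(φ ⬝ᵥ (effLaplacian (L ^ (K + 1 + 1)) M (aK a L (K + 1 + 1)) (((L ^ (K + 1 + 1) : ℕ) : ℝ) ^ 2) m2 *ᵥ φ) / 2)))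
    (r := fun K => thetaK a L (K + 1) 1 * a * (R K ^ 2 * Fintype.card (Tor M)) / 2)
    (fun K => by have := kingTheta_nonneg ha hL (k := K + 1) (n := 1) (by omega) le_rfl; positivity) hB (fun _ => hWm) (fun _ => hWb)
    (fun K _ => Real.measurable_exp.comp ((measurable_dotProduct_mulVec M _).div_const 2).neg)
    (fun K _ => Real.measurable_exp.comp ((measurable_dotProduct_mulVec M _).div_const 2).neg)
    (fun K τ _ => (integrable_exp_neg_action M hγ (effLaplacian_coercive_unif M ha hL (by omega) hm)).mono_measure Measure.restrict_le_self)
    fun K t ht τ hτ => ⟨0, ?_⟩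
  have hτ' : τ = false := by
    rcases τ with _ | _
    · rfl
    · exact absurd hτ (by simp)
  subst hτ'
  simp only [cond_false]
  refine (ae_dotProduct_le_smallField M (R K)).mono fun φ hφ => exp_neg_sandwich_of_abs_sub_le ?_
  refine (abs_action_sub_le_torus_of_eq M ha hL (k := K + 1) (n := 1) (by omega) le_rfl hm (L ^ (K + 1 + 1)) (by rw [pow_one, pow_succ, mul_comm]) (K + 1 + 1)
    rfl φ).trans ?_
  have : thetaK a L (K + 1) 1 * a * (φ ⬝ᵥ φ) ≤ thetaK a L (K + 1) 1 * a * (R K ^ 2 * Fintype.card (Tor M)) :=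
    mul_le_mul_of_nonneg_left hφ (mul_nonneg (kingTheta_nonneg ha hL (by omega) le_rfl) ha.le)
  linarith

end Binder

/-! ## §3 The apex statement in King's Gaussian model, one numeric hypothesis -/
section Main

variable {d : ℕ} (M : Fin d → ℕ) [hM : ∀ μ, NeZero (M μ)] {l₀ vol B R₀ c : ℝ} {W : (Tor M → ℝ) → ℝ} {Z : ℕ → ℝ → ℝ}

/-- **★★★ KING'S GAUSSIAN EFFECTIVE MEASURES: THE GENERATING FUNCTIONS CONVERGE** [folklore ∘ `KingModelLargeField.cauchy_genFun_kingTwoClass` + §1]: for `a, m² > 0`, `L ≥ 2`, `vol > 0`,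
`l₀ ≥ 0`, `c > 0`, a bounded measurable unit-scale observable `W` and the ONE numeric condition `e^{2l₀B}·√2^{|Tor M|}·e^{−γ₀R₀²/4} < 1` on the initial small-field radius, the FULL-SPACE dressed
partition functions `Z K t = ∫ exp(−½φ·Δ^{(K+1)}φ)·e^{tWφ} dφ` of King's block-RG effective measures (`Δ^{(K+1)} = Torus.effLaplacian (L^{K+1}) M a_{K+1} ((L^{K+1})²) m²`) satisfy NE7
`MatchingModConstants vol l₀ δ♭ Z` with a SUMMABLE remainder `δ♭`, `CauchySeq (K ↦ genFun Z K t)` for every `|t| ≤ l₀`, and `TendstoUniformlyOn (genFun Z) (genFunLim Z) atTop {|t| ≤ l₀}` — via the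
spine's own NE7 assembly (`HybridNE7.cauchy`) on the two-class King tower with radii `R_K = √(R₀² + cK)`. -/
theorem cauchy_genFun_kingGaussian {a : ℝ} (ha : 0 < a) {L : ℕ} [NeZero L] (hL : 2 ≤ L) {m2 : ℝ} (hm : 0 < m2) (hvol : 0 < vol) (hl₀ : 0 ≤ l₀) (hB : 0 ≤ B)
    (hWm : Measurable W) (hWb : ∀ φ, |W φ| ≤ B) (hc : 0 < c)
    (hnum : Real.exp (2 * (l₀ * B)) * Real.sqrt 2 ^ Fintype.card (Tor M) * Real.exp (-(((aminL a L)⁻¹ + m2⁻¹)⁻¹ * R₀ ^ 2 / 4)) < 1)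
    (hZ : ∀ K (t : ℝ), Z K t = ∫ φ : Tor M → ℝ, Real.exp (-(φ ⬝ᵥ (effLaplacian (L ^ (K + 1)) M (aK a L (K + 1)) (((L ^ (K + 1) : ℕ) : ℝ) ^ 2) m2 *ᵥ φ) / 2)) * Real.exp (t * W φ)) :
    MatchingModConstants vol l₀
        (hybridDelta vol (fun K => thetaK a L (K + 1) 1 * a * (Real.sqrt (R₀ ^ 2 + c * K) ^ 2 * Fintype.card (Tor M)) / 2 / vol)
          fun K => Real.exp (2 * (l₀ * B)) * Real.sqrt 2 ^ Fintype.card (Tor M) * Real.exp (-(((aminL a L)⁻¹ + m2⁻¹)⁻¹ * Real.sqrt (R₀ ^ 2 + c * K) ^ 2 / 4)) + 0) Z ∧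
      Summable (hybridDelta vol (fun K => thetaK a L (K + 1) 1 * a * (Real.sqrt (R₀ ^ 2 + c * K) ^ 2 * Fintype.card (Tor M)) / 2 / vol)
          fun K => Real.exp (2 * (l₀ * B)) * Real.sqrt 2 ^ Fintype.card (Tor M) * Real.exp (-(((aminL a L)⁻¹ + m2⁻¹)⁻¹ * Real.sqrt (R₀ ^ 2 + c * K) ^ 2 / 4)) + 0) ∧
      (∀ t : ℝ, |t| ≤ l₀ → CauchySeq fun K => genFun Z K t) ∧
      TendstoUniformlyOn (fun K t => genFun Z K t) (genFunLim Z) atTop {t | |t| ≤ l₀} := by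
  have hγ := gamma0_pos ha hL hm
  have hC : 0 ≤ Real.exp (2 * (l₀ * B)) * Real.sqrt 2 ^ Fintype.card (Tor M) := by positivity
  exact cauchy_genFun_kingTwoClass M ha hL hm hvol hl₀ hB hWm hWb (R := fun K => Real.sqrt (R₀ ^ 2 + c * K)) (fun K => Real.sqrt_nonneg _)
    (fun K => weight_affine_lt_one hC hγ.le hc.le hnum K) (summable_weight_affine _ hγ hc R₀) (summable_radius_affine M ha hL hvol R₀ hc.le) hZ

/-- **★★ THE K3⁗ KEYED-CORE-EDGE SHAPE ON THE TWO-CLASS TOWER** [folklore ∘ `KingModelLargeField.core_kingTwoClass` + `summable_radius_affine`]: with the affine radius and the bad class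
`{true}` GENUINE, `∃ δ, Spine.NE7.Core l₀ vol univ {true} A B δ ∧ Summable δ` for King's consecutive runs (`vol > 0`). -/
theorem exists_core_summable_kingTwoClass {a : ℝ} (ha : 0 < a) {L : ℕ} [NeZero L] (hL : 2 ≤ L) {m2 : ℝ} (hm : 0 < m2) (hvol : 0 < vol) (hB : 0 ≤ B) (hWm : Measurable W)
    (hWb : ∀ φ, |W φ| ≤ B) (hc : 0 ≤ c) :
    ∃ δ : ℕ → ℝ, Summit.QuantumFields.BalabanUV.T4Continuum.Spine.NE7.Core l₀ vol (fun _ => (Finset.univ : Finset Bool)) (fun _ _ => ({true} : Finset Bool))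
      (fun K t τ => ∫ φ in (bif τ then {φ : Tor M → ℝ | ∀ x, |φ x| ≤ Real.sqrt (R₀ ^ 2 + c * K)}ᶜ else {φ : Tor M → ℝ | ∀ x, |φ x| ≤ Real.sqrt (R₀ ^ 2 + c * K)}),
        Real.exp (-(φ ⬝ᵥ (effLaplacian (L ^ (K + 1)) M (aK a L (K + 1)) (((L ^ (K + 1) : ℕ) : ℝ) ^ 2) m2 *ᵥ φ) / 2)) * Real.exp (t * W φ))
      (fun K t τ => ∫ φ in (bif τ then {φ : Tor M → ℝ | ∀ x, |φ x| ≤ Real.sqrt (R₀ ^ 2 + c * K)}ᶜ else {φ : Tor M → ℝ | ∀ x, |φ x| ≤ Real.sqrt (R₀ ^ 2 + c * K)}),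
        Real.exp (-(φ ⬝ᵥ (effLaplacian (L ^ (K + 1 + 1)) M (aK a L (K + 1 + 1)) (((L ^ (K + 1 + 1) : ℕ) : ℝ) ^ 2) m2 *ᵥ φ) / 2)) * Real.exp (t * W φ)) δ ∧ Summable δ :=
  ⟨fun K => thetaK a L (K + 1) 1 * a * (Real.sqrt (R₀ ^ 2 + c * K) ^ 2 * Fintype.card (Tor M)) / 2 / vol,
    YMDAG.N18.KingModelLargeField.core_kingTwoClass M (R := fun K => Real.sqrt (R₀ ^ 2 + c * K)) ha hL hm hB hWm hWb fun K => le_of_eq (by field_simp),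
    summable_radius_affine M ha hL hvol R₀ hc⟩

end Main

end YMDAG.N18.KingModelGaussianLimit

end
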